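import Literature.ComputerArithmetic.Rump2006.CholeskyPositiveDefinite

/-!
# Floating-point Cholesky with quotients flushed to zero (stored zeros of a sparse factor)

[Rump2006] Lemma 2.1 and the tree's `CholeskyRun` read the standard model (1.1) WITHOUT its
underflow unit: every off-diagonal entry of the computed factor is `r̃_{ij} = fl(s̃ / r̃_{ii})` with a
RELATIVE error `≤ u`. A sparse code (CHOLMOD with relaxed supernodes) stores explicit zeros in the
factor. Such a stored zero is either an exact zero (`s̃ = 0`: padding, exact cancellation — the
relative model holds trivially) or a quotient that UNDERFLOWED to zero, in which case only an
ABSOLUTE bound `|s̃| ≤ E_{ij}` on the numerator is available ((1.1) of [Rump2006] WITH its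
underflow unit; in binary64 with gradual underflow `|s̃| < 2^{-1075} r̃_{ii}`, but `E` is abstract
here) and `CholeskyRun` fails as stated.

This file shows that such a run (`CholeskyRunFlush u E A R̃`) IS an `eta`-free `CholeskyRun` of a
nearby SYMMETRIC matrix `A'` that agrees with `A` on the diagonal and satisfies
`|A' - A| (1-u)^n ≤ E` entrywise (`CholeskyRunFlush.exists_choleskyRun`). Consequently Rump's
interval-matrix Corollary 2.7 (`quadForm_pos_of_shifted_cholesky_interval`) applies with the radius
`E / (1-u)^n`: a certificate only has to enlarge its radius by the (astronomically small) flush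
allowance (`quadForm_pos_of_shifted_cholesky_flush`, `posDef_of_shifted_cholesky_flush`; this is
the `checks.eta_allowance` of cap.ila.spd ≥ 0.2.1).

The key step is a re-centring lemma for evaluation trees (`CTree.exists_recentre`): the computed
value of `fl(c - Σ_ℓ z_ℓ)` can be moved to ANY target by moving the constant `c` by at most the same
amount times `(1-u)^{-k}` (`k` = number of terms), keeping every rounding factor — hence
well-formedness under the standard model — unchanged.
[cite: Rump2006, (1.1), Lemma 2.1, Corollary 2.7] [cite: Higham2002ASNA, Lemma 8.4]
[cite: Rump2010Verification, Lemma 10.14]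
-/

namespace Literature.ComputerArithmetic.Rump2006

open Finset Matrix
open Literature.ComputerArithmetic.Higham2002

variable {K : Type*} [Field K] [LinearOrder K] [IsStrictOrderedRing K]

section Recentre

variable {u : K}

/-- One rounding step re-centred: if `v = fl(x)` in the standard model (`|v - x| ≤ u |x|`) then for
every shift `θ` of the OUTPUT there is a shift `θ'` of the INPUT, `|θ'| (1-u) ≤ |θ|`, with
`v - θ = fl(x - θ')` under the SAME relative rounding (`|(v-θ) - (x-θ')| ≤ u |x - θ'|`).
[cite: Higham2002ASNA, (2.4) and Lemma 8.4] [cite: Rump2006, (1.1)] -/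
theorem round_recentre (hu : 0 ≤ u) (hu1 : u < 1) {v x : K} (hv : |v - x| ≤ u * |x|) (θ : K) :
    ∃ θ' : K, |θ'| * (1 - u) ≤ |θ| ∧ |(v - θ) - (x - θ')| ≤ u * |x - θ'| := by
  by_cases hx : x = 0
  · subst hx
    have hv0 : v = 0 := by simpa using hv
    refine ⟨θ, ?_, ?_⟩
    · nlinarith [abs_nonneg θ]
    · rw [hv0, sub_self, abs_zero]
      exact mul_nonneg hu (abs_nonneg _)
  · -- `φ := v / x` satisfies `|φ - 1| ≤ u`, hence `φ ≥ 1 - u > 0`; take `θ' := θ / φ`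
    obtain ⟨φ, hφ, hvx⟩ : ∃ φ : K, |φ - 1| ≤ u ∧ v = φ * x := by
      refine ⟨v / x, ?_, (div_mul_cancel₀ v hx).symm⟩
      rw [show v / x - 1 = (v - x) / x by field_simp, abs_div, div_le_iff₀ (abs_pos.mpr hx)]
      exact hv
    obtain ⟨k1, k2⟩ := abs_le.mp hφ
    have hφpos : 0 < φ := by linarith
    have hφne : φ ≠ 0 := hφpos.ne'
    refine ⟨θ / φ, ?_, ?_⟩
    · rw [abs_div, abs_of_pos hφpos, div_mul_eq_mul_div, div_le_iff₀ hφpos]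
      exact mul_le_mul_of_nonneg_left (by linarith) (abs_nonneg θ)
    · have hθ : φ * (θ / φ) = θ := by field_simp
      have hid : v - θ - (x - θ / φ) = (φ - 1) * (x - θ / φ) := by
        rw [hvx]
        nth_rewrite 1 [← hθ]
        ring
      rw [hid, abs_mul]
      exact mul_le_mul_of_nonneg_right hφ (abs_nonneg _)

/-- RE-CENTRING an evaluation tree: for a well-formed (standard-model) evaluation `e` of
`c - Σ_ℓ z_ℓ` with `k` terms and computed value `s̃`, and ANY `θ`, there is a well-formed evaluation
`e'` of `c' - Σ_ℓ z_ℓ` with the SAME terms (in the same order, same tree shape and rounding factors)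
whose computed value is exactly `s̃ - θ`, where `|c' - c| (1-u)^k ≤ |θ|`. Used with `θ = s̃`: a
numerator that was flushed to zero by the division is the EXACT zero numerator of a nearby datum.
[cite: Higham2002ASNA, Lemma 8.4] [cite: Rump2006, Lemma 2.1 and (1.1)] -/
theorem CTree.exists_recentre (hu : 0 ≤ u) (hu1 : u < 1) :
    ∀ e : CTree K, e.WF u → ∀ θ : K, ∃ e' : CTree K, e'.WF u ∧ e'.terms = e.terms ∧
      e'.val = e.val - θ ∧ |e'.const - e.const| * (1 - u) ^ e.terms.length ≤ |θ|
  | .start c, _, θ =>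
      ⟨.start (c - θ), trivial, rfl, rfl, by simp [CTree.const, CTree.terms]⟩
  | .sub v e t, ⟨he, ht, hv⟩, θ => by
      obtain ⟨θ', hθ', hround⟩ := round_recentre hu hu1 hv θ
      obtain ⟨e', he', hterms, hval, hconst⟩ := CTree.exists_recentre hu hu1 e he θ'
      refine ⟨.sub (v - θ) e' t, ⟨he', ht, ?_⟩, ?_, rfl, ?_⟩
      · have h1 : e'.val - t.val = e.val - t.val - θ' := by rw [hval]; ring
        rw [h1]
        exact hround
      · simp only [CTree.terms, hterms]
      · simp only [CTree.const, CTree.terms, List.length_append]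
        have h1u : 0 < 1 - u := by linarith
        have hle1 : (1 - u) ^ (e.terms.length + t.terms.length) ≤
            (1 - u) ^ e.terms.length * (1 - u) := by
          rw [← pow_succ]
          exact pow_le_pow_of_le_one h1u.le (by linarith) (by
            have := t.terms_length_pos; omega)
        calc |e'.const - e.const| * (1 - u) ^ (e.terms.length + t.terms.length)
            ≤ |e'.const - e.const| * ((1 - u) ^ e.terms.length * (1 - u)) :=
              mul_le_mul_of_nonneg_left hle1 (abs_nonneg _)
          _ = |e'.const - e.const| * (1 - u) ^ e.terms.length * (1 - u) := by ring
          _ ≤ |θ'| * (1 - u) := mul_le_mul_of_nonneg_right hconst h1u.le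
          _ ≤ |θ| := hθ'
  | .fsub v e z, ⟨he, hv⟩, θ => by
      obtain ⟨θ', hθ', hround⟩ := round_recentre hu hu1 hv θ
      obtain ⟨e', he', hterms, hval, hconst⟩ := CTree.exists_recentre hu hu1 e he θ'
      refine ⟨.fsub (v - θ) e' z, ⟨he', ?_⟩, ?_, rfl, ?_⟩
      · have h1 : e'.val - z = e.val - z - θ' := by rw [hval]; ring
        rw [h1]
        exact hround
      · simp only [CTree.terms, hterms]
      · simp only [CTree.const, CTree.terms, List.length_append, List.length_singleton]
        have h1u : 0 < 1 - u := by linarith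
        calc |e'.const - e.const| * (1 - u) ^ (e.terms.length + 1)
            = |e'.const - e.const| * (1 - u) ^ e.terms.length * (1 - u) := by ring
          _ ≤ |θ'| * (1 - u) := mul_le_mul_of_nonneg_right hconst h1u.le
          _ ≤ |θ| := hθ'

end Recentre

section Flush

variable {u : K} {n : ℕ}

/-- A floating-point Cholesky run IN ANY ORDER that RUNS TO COMPLETION, exactly as `CholeskyRun`
([Rump2006] (2.1), (2.6)) except that an off-diagonal entry may also be a STORED ZERO whose numerator
`s̃` is only known ABSOLUTELY: `r̃_{ij} = 0` and `|s̃| ≤ E_{ij}` (a quotient `s̃ / r̃_{ii}` flushed to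
zero by underflow — (1.1) of [Rump2006] WITH its underflow unit — or an exact zero, `E_{ij} ≥ 0`
arbitrary). This is what a sparse library factor with explicitly stored zeros certifies under the
standard model with gradual underflow. [cite: Rump2006, (1.1), (2.1) and (2.6)]
[cite: Higham2002ASNA, Algorithm 10.2 and (2.4)] -/
structure CholeskyRunFlush (u : K) (E A R : Matrix (Fin n) (Fin n) K) : Prop where
  lower : ∀ i j : Fin n, j < i → R i j = 0
  offDiag : ∀ i j : Fin n, i < j → ∃ e : CTree K, e.WF u ∧ e.const = A i j ∧
    e.terms.Perm (prods R i j) ∧ R i i ≠ 0 ∧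
    (|R i j - e.val / R i i| ≤ u * |e.val / R i i| ∨ (R i j = 0 ∧ |e.val| ≤ E i j))
  diag : ∀ j : Fin n, ∃ e : CTree K, e.WF u ∧ e.const = A j j ∧ e.terms.Perm (prods R j j) ∧
    ∃ δ : K, |δ| ≤ u ∧ R j j ^ 2 = e.val * (1 + δ) ^ 2

omit [LinearOrder K] [IsStrictOrderedRing K] in
/-- the number of subtracted products in stage `(i, j)` is `i ≤ n`. [cite: Rump2006, (2.1)] -/
theorem length_prods (R : Matrix (Fin n) (Fin n) K) (i j : Fin n) : (prods R i j).length = i.val := by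
  simp [prods]

omit [IsStrictOrderedRing K] in
/-- An `eta`-free run is a flush run for every allowance `E`. [cite: Rump2006, (2.1) and (2.6)] -/
theorem CholeskyRun.toFlush {E A R : Matrix (Fin n) (Fin n) K} (h : CholeskyRun u A R) :
    CholeskyRunFlush u E A R where
  lower := h.lower
  offDiag i j hij := by
    obtain ⟨e, he, hc, hp, hii, hr⟩ := h.offDiag i j hij
    exact ⟨e, he, hc, hp, hii, Or.inl hr⟩
  diag := h.diag

/-- the per-entry re-centring behind `exists_choleskyRun`: in stage `(i, j)`, `i < j`, of a flush
run there is a datum `c` with `|c - a_{ij}| (1-u)^n ≤ E_{ij}` for which the SAME computed `r̃_{ij}`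
is an `eta`-free standard-model quotient. [cite: Rump2006, Lemma 2.1 and (1.1)]
[cite: Higham2002ASNA, Lemma 8.4] -/
theorem CholeskyRunFlush.exists_const (hu : 0 ≤ u) (hu1 : u < 1) {E A R : Matrix (Fin n) (Fin n) K}
    (hE0 : ∀ i j, 0 ≤ E i j) (h : CholeskyRunFlush u E A R) (i j : Fin n) (hij : i < j) :
    ∃ c : K, (∃ e : CTree K, e.WF u ∧ e.const = c ∧ e.terms.Perm (prods R i j) ∧ R i i ≠ 0 ∧
      |R i j - e.val / R i i| ≤ u * |e.val / R i i|) ∧ |c - A i j| * (1 - u) ^ n ≤ E i j := by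
  obtain ⟨e, he, hc, hp, hii, hr⟩ := h.offDiag i j hij
  rcases hr with hr | ⟨hz, hE⟩
  · refine ⟨A i j, ⟨e, he, hc, hp, hii, hr⟩, ?_⟩
    rw [sub_self, abs_zero, zero_mul]
    exact hE0 i j
  · obtain ⟨e', he', hterms, hval, hconst⟩ := CTree.exists_recentre hu hu1 e he e.val
    have hlen : e.terms.length = i.val := by rw [hp.length_eq, length_prods]
    refine ⟨e'.const, ⟨e', he', rfl, hterms ▸ hp, hii, ?_⟩, ?_⟩
    · rw [hval, sub_self, zero_div, hz, sub_zero, abs_zero, mul_zero]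
    · have h1u : 0 < 1 - u := by linarith
      have hpow : (1 - u) ^ n ≤ (1 - u) ^ e.terms.length :=
        pow_le_pow_of_le_one h1u.le (by linarith) (by rw [hlen]; exact i.isLt.le)
      calc |e'.const - A i j| * (1 - u) ^ n
          ≤ |e'.const - A i j| * (1 - u) ^ e.terms.length :=
            mul_le_mul_of_nonneg_left hpow (abs_nonneg _)
        _ = |e'.const - e.const| * (1 - u) ^ e.terms.length := by rw [hc]
        _ ≤ |e.val| := hconst
        _ ≤ E i j := hE

/-- STORED ZEROS COST A RADIUS, NOT THE THEOREM: a flush run of a symmetric `A` with allowance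
`E ≥ 0` is an `eta`-free `CholeskyRun` (same computed factor `R̃`) of a SYMMETRIC `A'` with the same
diagonal and `|A' - A| (1-u)^n ≤ E` entrywise (read `E` symmetrically: the bound at `(j, i)`,
`i < j`, is `E_{ij}`). [cite: Rump2006, Lemma 2.1, (1.1) and Corollary 2.7]
[cite: Higham2002ASNA, Lemma 8.4] -/
theorem CholeskyRunFlush.exists_choleskyRun (hu : 0 ≤ u) (hu1 : u < 1)
    {E A R : Matrix (Fin n) (Fin n) K} (hA : Aᵀ = A) (hE0 : ∀ i j, 0 ≤ E i j)
    (h : CholeskyRunFlush u E A R) :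
    ∃ A' : Matrix (Fin n) (Fin n) K, A'ᵀ = A' ∧ CholeskyRun u A' R ∧ (∀ i, A' i i = A i i) ∧
      ∀ i j, |A' i j - A i j| * (1 - u) ^ n ≤ (if i < j then E i j else E j i) := by
  classical
  have hsym : ∀ i j, A i j = A j i := fun i j => by
    have := congrFun (congrFun hA j) i
    rwa [Matrix.transpose_apply] at this
  -- the re-centred constants, chosen once per pair `i < j`
  let c : ∀ i j : Fin n, i < j → K := fun i j hij => Classical.choose (h.exists_const hu hu1 hE0 i j hij)
  have hc : ∀ i j (hij : i < j), (∃ e : CTree K, e.WF u ∧ e.const = c i j hij ∧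
      e.terms.Perm (prods R i j) ∧ R i i ≠ 0 ∧ |R i j - e.val / R i i| ≤ u * |e.val / R i i|) ∧
      |c i j hij - A i j| * (1 - u) ^ n ≤ E i j :=
    fun i j hij => Classical.choose_spec (h.exists_const hu hu1 hE0 i j hij)
  let A' : Matrix (Fin n) (Fin n) K := fun i j =>
    if hij : i < j then c i j hij else if hji : j < i then c j i hji else A i j
  have hup : ∀ i j (hij : i < j), A' i j = c i j hij := fun i j hij => by
    simp only [A', dif_pos hij]
  have hlo : ∀ i j (hji : j < i), A' i j = c j i hji := fun i j hji => by
    simp only [A', dif_neg (lt_asymm hji), dif_pos hji]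
  have hdg : ∀ i, A' i i = A i i := fun i => by
    simp only [A', dif_neg (lt_irrefl i)]
  refine ⟨A', ?_, ⟨h.lower, ?_, ?_⟩, hdg, ?_⟩
  · ext i j
    rw [Matrix.transpose_apply]
    rcases lt_trichotomy i j with hij | rfl | hji
    · rw [hup i j hij, hlo j i hij]
    · rfl
    · rw [hlo i j hji, hup j i hji]
  · intro i j hij
    obtain ⟨⟨e, he, hce, hp, hii, hr⟩, -⟩ := hc i j hij
    exact ⟨e, he, by rw [hce, hup i j hij], hp, hii, hr⟩
  · intro j
    obtain ⟨e, he, hce, hp, hδ⟩ := h.diag j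
    exact ⟨e, he, by rw [hce, hdg], hp, hδ⟩
  · intro i j
    rcases lt_trichotomy i j with hij | rfl | hji
    · rw [if_pos hij, hup i j hij]; exact (hc i j hij).2
    · rw [if_neg (lt_irrefl i), hdg, sub_self, abs_zero, zero_mul]; exact hE0 i i
    · rw [if_neg (lt_asymm hji), hlo i j hji, hsym i j]; exact (hc j i hji).2

/-- RUMP 2006 COROLLARY 2.7 / RUMP 2010 LEMMA 10.14 FOR A FACTOR WITH STORED ZEROS: let
`[A - Rad, A + Rad]` be a symmetric interval matrix (`Rad = Radᵀ ≥ 0`, Collatz pair `Rad w ≤ r w`,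
`w > 0`), `Ã = Ãᵀ` agree with `A` off the diagonal with `ã_{ii} ≤ a_{ii} - c - r - r_E`; suppose the
floating-point Cholesky decomposition of `Ã` runs to completion IN ANY ORDER with positive computed
pivots, every stored off-diagonal zero having a numerator `|s̃_{ij}| ≤ E_{ij}` (`E = Eᵀ ≥ 0`, Collatz
pair `E v ≤ r_E (1-u)^n v`, `v > 0`, i.e. `‖E‖₂ (1-u)^{-n} ≤ r_E`), and `Σ_j φ_{j+2} ã_{jj} ≤ c`. Then
EVERY `X` with `|X - A| ≤ Rad` satisfies `yᵀ X y > 0` for `y ≠ 0`. The flush allowance enters ONLY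
as the extra radius `r_E` (its own Collatz vector; `Rad = 0`, `r = 0` is the point case).
[cite: Rump2006, Corollary 2.7 and (1.1)] [cite: Rump2010Verification, Lemma 10.14] -/
theorem quadForm_pos_of_shifted_cholesky_flush (hu : 0 ≤ u) (h2n : 2 * ((n : K) + 1) * u < 1)
    {A At R E Rad : Matrix (Fin n) (Fin n) K} (hAt : Atᵀ = At) (hE : Eᵀ = E)
    (hE0 : ∀ i j, 0 ≤ E i j) (hrun : CholeskyRunFlush u E At R) (hpos : ∀ j, 0 < R j j)
    {v : Fin n → K} (hv : ∀ i, 0 < v i) {rE : K}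
    (hrE : ∀ i, (E *ᵥ v) i ≤ rE * (1 - u) ^ n * v i) (hRad : Radᵀ = Rad)
    (hRad0 : ∀ i j, 0 ≤ Rad i j) {w : Fin n → K} (hw : ∀ i, 0 < w i) {r : K}
    (hr : ∀ i, (Rad *ᵥ w) i ≤ r * w i) {c : K} (hoff : ∀ i j, i ≠ j → At i j = A i j)
    (hdiag : ∀ i, At i i ≤ A i i - c - r - rE)
    (hc : ∑ j : Fin n, gamma u (j.val + 2) / (1 - gamma u (j.val + 2)) * At j j ≤ c)
    (X : Matrix (Fin n) (Fin n) K) (hX : ∀ i j, |X i j - A i j| ≤ Rad i j)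
    (y : Fin n → K) (hy : y ≠ 0) : 0 < y ⬝ᵥ (X *ᵥ y) := by
  have hu1 : u < 1 := by
    have hn : (1 : K) ≤ (n : K) + 1 := by
      have := Nat.cast_nonneg (α := K) n; linarith
    nlinarith
  have h1u : 0 < (1 - u) ^ n := pow_pos (by linarith) n
  have hEsym : ∀ i j, E i j = E j i := fun i j => by
    have := congrFun (congrFun hE j) i
    rwa [Matrix.transpose_apply] at this
  obtain ⟨A', hA', hrun', hdg, hbd⟩ := hrun.exists_choleskyRun hu hu1 hAt hE0
  -- flush radius `RadE := E / (1-u)^n`, target `A° := A + (A' - Ã)`; `|A - A°| ≤ RadE`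
  let RadE : Matrix (Fin n) (Fin n) K := fun i j => E i j / (1 - u) ^ n
  let A0 : Matrix (Fin n) (Fin n) K := fun i j => A i j + (A' i j - At i j)
  have hRadE : RadEᵀ = RadE := by
    ext i j; simp only [RadE, Matrix.transpose_apply, hEsym i j]
  have hRadE0 : ∀ i j, 0 ≤ RadE i j := fun i j => div_nonneg (hE0 i j) h1u.le
  have hrv : ∀ i, (RadE *ᵥ v) i ≤ rE * v i := by
    intro i
    have hmv : (RadE *ᵥ v) i = (E *ᵥ v) i / (1 - u) ^ n := by
      simp only [RadE, Matrix.mulVec, dotProduct, Finset.sum_div]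
      exact Finset.sum_congr rfl fun j _ => by ring
    rw [hmv, div_le_iff₀ h1u]
    calc (E *ᵥ v) i ≤ rE * (1 - u) ^ n * v i := hrE i
      _ = rE * v i * (1 - u) ^ n := by ring
  have hoff' : ∀ i j, i ≠ j → A' i j = A0 i j := fun i j hij => by
    simp only [A0, hoff i j hij]; ring
  have hdiag' : ∀ i, A' i i ≤ A0 i i - (c + r + rE) := fun i => by
    simp only [A0, hdg i]; linarith [hdiag i]
  have hc' : ∑ j : Fin n, gamma u (j.val + 2) / (1 - gamma u (j.val + 2)) * A' j j ≤ c := by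
    simpa only [hdg] using hc
  have hAA0 : ∀ i j, |A i j - A0 i j| ≤ RadE i j := by
    intro i j
    have h1 : |A i j - A0 i j| = |A' i j - At i j| := by
      simp only [A0]; rw [← abs_neg]; ring_nf
    rw [h1, le_div_iff₀ h1u]
    have h2 := hbd i j
    rcases lt_trichotomy i j with hij | rfl | hji
    · simpa only [if_pos hij] using h2
    · simpa only [if_neg (lt_irrefl i)] using h2
    · simpa only [if_neg (lt_asymm hji), hEsym j i] using h2
  have hX0 : ∀ i j, |X i j - A0 i j| ≤ (Rad + RadE) i j := fun i j => by
    rw [Matrix.add_apply]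
    calc |X i j - A0 i j| = |(X i j - A i j) + (A i j - A0 i j)| := by ring_nf
      _ ≤ |X i j - A i j| + |A i j - A0 i j| := abs_add_le _ _
      _ ≤ Rad i j + RadE i j := add_le_add (hX i j) (hAA0 i j)
  -- the four pieces of Rump's Corollary 2.7, with two Collatz pairs
  have h1 := hrun'.neg_mul_lt_quadForm hu h2n hA' hpos y hy
  have h2 := quadForm_shift_le (d := c + r + rE) hoff' hdiag' y
  have h3 := quadForm_sub_abs_le hX0 y
  have hsplit : (fun i => |y i|) ⬝ᵥ ((Rad + RadE) *ᵥ fun i => |y i|) =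
      (fun i => |y i|) ⬝ᵥ (Rad *ᵥ fun i => |y i|) +
        (fun i => |y i|) ⬝ᵥ (RadE *ᵥ fun i => |y i|) := by
    rw [Matrix.add_mulVec, dotProduct_add]
  rw [hsplit] at h3
  have h4 := quadForm_le_of_mulVec_le hRad hRad0 hw hr (fun i => |y i|)
  have h5 := quadForm_le_of_mulVec_le hRadE hRadE0 hv hrv (fun i => |y i|)
  have hyy : (fun i => |y i|) ⬝ᵥ (fun i => |y i|) = y ⬝ᵥ y := by
    simp only [dotProduct]; exact sum_congr rfl fun i _ => abs_mul_abs_self _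
  rw [hyy] at h4 h5
  have hxx : 0 ≤ y ⬝ᵥ y := sum_nonneg fun i _ => mul_self_nonneg _
  nlinarith [mul_le_mul_of_nonneg_right hc' hxx]

/-- Over `ℝ`, the point case (`Rad = 0`) packaged as Mathlib's `Matrix.PosDef` (symmetry of `A`
follows from that of `Ã`): the sparse-Cholesky lambda_min floor with STORED ZEROS CHARGED as the
extra radius `r_E` (cap.ila.spd ≥ 0.2.1, `checks.eta_allowance`). [cite: Rump2006, Corollary 2.4 and Corollary 2.7]
[cite: Rump2010Verification, Section 10.8.1] -/
theorem posDef_of_shifted_cholesky_flush {n : ℕ} {u : ℝ} (hu : 0 ≤ u)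
    (h2n : 2 * ((n : ℝ) + 1) * u < 1) {A At R E : Matrix (Fin n) (Fin n) ℝ} (hAt : Atᵀ = At)
    (hE : Eᵀ = E) (hE0 : ∀ i j, 0 ≤ E i j) (hrun : CholeskyRunFlush u E At R)
    (hpos : ∀ j, 0 < R j j) {v : Fin n → ℝ} (hv : ∀ i, 0 < v i) {rE c : ℝ}
    (hrE : ∀ i, (E *ᵥ v) i ≤ rE * (1 - u) ^ n * v i) (hoff : ∀ i j, i ≠ j → At i j = A i j)
    (hdiag : ∀ i, At i i ≤ A i i - c - rE)
    (hc : ∑ j : Fin n, gamma u (j.val + 2) / (1 - gamma u (j.val + 2)) * At j j ≤ c) :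
    A.PosDef := by
  have hA : A.IsHermitian := by
    rw [Matrix.IsHermitian, Matrix.conjTranspose_eq_transpose_of_trivial]
    ext i j
    rw [Matrix.transpose_apply]
    by_cases hij : i = j
    · rw [hij]
    · have h1 := hoff j i (Ne.symm hij)
      have h2 := hoff i j hij
      have h3 : At j i = At i j := by
        have := congrFun (congrFun hAt i) j
        rw [Matrix.transpose_apply] at this
        exact this
      rw [← h1, h3, h2]
  refine Matrix.PosDef.of_dotProduct_mulVec_pos hA fun x hx => ?_
  rw [star_trivial]
  have hRad : (0 : Matrix (Fin n) (Fin n) ℝ)ᵀ = 0 := Matrix.transpose_zero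
  have hr : ∀ i, ((0 : Matrix (Fin n) (Fin n) ℝ) *ᵥ v) i ≤ 0 * v i := fun i => by
    rw [Matrix.zero_mulVec, zero_mul]; exact le_rfl
  exact quadForm_pos_of_shifted_cholesky_flush hu h2n hAt hE hE0 hrun hpos hv hrE hRad
    (fun _ _ => le_rfl) hv hr hoff (fun i => by linarith [hdiag i]) hc A
    (fun i j => by rw [sub_self, abs_zero]; exact le_rfl) x hx

/-- Sanity (non-vacuity of `CholeskyRunFlush` beyond `CholeskyRun`): with `u = 0` the `2 × 2` datum
`Ã = [[4, 1], [1, 4]]` and the factor `R̃ = [[2, 0], [0, 2]]` — whose `(0,1)` entry is a STORED ZERO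
although the exact quotient is `1/2` — form a flush run with allowance `E_{01} = 1` (numerator
`s̃ = 1`), but NOT an `eta`-free `CholeskyRun`. -/
example : CholeskyRunFlush (0 : ℚ) !![0, (1 : ℚ); 1, 0] !![(4 : ℚ), 1; 1, 4] !![(2 : ℚ), 0; 0, 2] where
  lower i j h := by
    fin_cases i <;> fin_cases j <;> simp_all
  offDiag i j h := by
    fin_cases i <;> fin_cases j
    · exact absurd h (lt_irrefl _)
    · refine ⟨CTree.start 1, trivial, by simp [CTree.const], by simp [CTree.terms, prods], by simp, ?_⟩
      right
      simp [CTree.val]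
    · exact absurd (Fin.lt_def.mp h) (by norm_num)
    · exact absurd h (lt_irrefl _)
  diag j := by
    fin_cases j
    · refine ⟨CTree.start 4, trivial, by simp [CTree.const], by simp [CTree.terms, prods], 0,
        by simp, ?_⟩
      simp [CTree.val]; norm_num
    · refine ⟨CTree.fsub 4 (CTree.start 4) 0, ⟨trivial, by simp [CTree.val]⟩, by simp [CTree.const],
        ?_, 0, by simp, ?_⟩
      · simp [CTree.terms, prods]
      · simp [CTree.val]; norm_num

end Flush

end Literature.ComputerArithmetic.Rump2006
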